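import Mathlib
import HarnessLib
import Summits.Ventures.LatticeQCDFlow.Exactness.DegreeOneLayerEquiv
import Summits.Ventures.LatticeQCDFlow.Exactness.NCPCircleJacobian

/-!
# The NCP coupling layers of the U(1) flows are measurable equivalences, members are lists of certified layers: FT-HMC through them is exact end to end

HONEST FRAMING: exact (Metropolis-corrected) sampling algorithms for lattice gauge theory;
figures of merit are autocorrelation/cost numbers at stated couplings and volumes; no
continuum-physics claim.

Venture `LatticeQCDFlow` (cell pub-lqcd), topic `Exactness`; FANOUT row 14 (`eng-flowhmc`, engine
`latflow.fthmc`: its `u1-flow-trained` member runs FT-HMC through a trained U(1) flow of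
rows 3 / 4, i.e. through a LIST of NCP-mixture coupling layers).  NEW WORK of the cell over
Mathlib and the tree's `TransformedHMC` (`thmc_hmc_exact`, row 7), `FlowPushforward`
(`HasJacobian.comp`, `hasJacobian_id`), `Scaling/EntropyBudgetCoupling` (`Theory2.coupleEquiv`,
row 31), `NCPCircleJacobian` (row 14: the NCP lift, its derivative, mixtures) and
`DegreeOneLayerEquiv` (row 14: degree-one layers as measurable equivalences,
`thmc_hmc_exact_coupleEquiv_of_degreeOne`).  Nothing is cited as a fact.  Printed counterparts,
named only: Kanwar et al. 2020 (gauge-equivariant U(1) flows: active links moved by mixtures of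
non-compact-projection circle diffeomorphisms; a flow = many coupling layers), Lüscher 2010 §2.

## Content

* `measurable_ncpMixture_prod`, `measurable_ncpMixtureJac_prod` — the NCP-mixture lift and its
  Jacobian factor are jointly measurable in (angle, parameters) for measurable weights, offsets,
  scales and shift on any parameter space;
* **`exists_coupleEquiv_ncpMixture`** — NCP-mixture coupling layers (convex weights, positive
  scales, offsets, shift measurable in the frozen links) are measurable EQUIVALENCES of
  `ι → U(1)`: a family `ψ b y : U(1) ≃ᵐ U(1)` realising the mixture on representatives with
  forward and inverse maps jointly measurable in (link, frozen links);
* **`thmc_hmc_exact_coupleEquiv_ncpMixture`** — FT-HMC through such a layer, with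
  `J = coupleJac`, `jac b y (e^{iθ}) = Σ_i w_i · 2l_i / ((1 + l_i²) + (1 − l_i²) cos(θ − a_i))`,
  is exact for any measurable `S`, `T`, momenta space and measure-preserving involutive
  integrator;
* `hasJacobian_trans`, **`hasJacobian_foldr_trans`**, **`thmc_hmc_exact_foldr`** — MEMBERS: a
  list of layers `(F_k, J_k)` on any measurable space, each a measurable equivalence with
  `HasJacobian vol F_k (ofReal ∘ J_k)` and `J_k > 0` measurable, composes (head first) to the
  measurable equivalence `F_n ∘ ⋯ ∘ F_1` with Jacobian `v ↦ J_1(v) J_2(F_1 v) ⋯` — positive,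
  measurable, the running log-det the engine accumulates — and FT-HMC through the member is
  exact.

NOT here: momentum refresh / ergodicity; SU(N); any number.
-/

noncomputable section

namespace Summit.Ventures.LatticeQCDFlow.Exactness

open Real Set Function MeasureTheory Filter Summit.Ventures.LatticeQCDFlow.Theory2
open ProbabilityTheory ProbabilityTheory.Kernel
open Literature.MathematicalPhysics.QuantumFieldTheory (haarProbability)
open scoped NNReal ENNReal Topology

/-! ## The instance: NCP-mixture layers (Kanwar et al. 2020) inside FT-HMC -/

section NCP

/-- The NCP-mixture lift is jointly measurable in (angle, parameters) for measurable weights,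
offsets, scales and shift (any parameter space). -/
theorem measurable_ncpMixture_prod {Y : Type*} [MeasurableSpace Y] {m : ℕ}
    {w a l : Y → Fin m → ℝ} {t : Y → ℝ}
    (hw : ∀ i, Measurable fun y => w y i) (ha : ∀ i, Measurable fun y => a y i)
    (hlm : ∀ i, Measurable fun y => l y i) (ht : Measurable t) :
    Measurable fun q : ℝ × Y => t q.2 + ∑ i, w q.2 i * (a q.2 i + ((q.1 - a q.2 i) +
      2 * arctan ((l q.2 i - 1) * sin (q.1 - a q.2 i) /
        ((1 + l q.2 i) + (1 - l q.2 i) * cos (q.1 - a q.2 i))))) := by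
  refine (ht.comp measurable_snd).add (Finset.measurable_sum _ fun i _ => ?_)
  have hai : Measurable fun q : ℝ × Y => a q.2 i := (ha i).comp measurable_snd
  have hli : Measurable fun q : ℝ × Y => l q.2 i := (hlm i).comp measurable_snd
  have hθa : Measurable fun q : ℝ × Y => q.1 - a q.2 i := measurable_fst.sub hai
  refine ((hw i).comp measurable_snd).mul (hai.add (hθa.add (measurable_const.mul ?_)))
  exact measurable_arctan.comp (((hli.sub measurable_const).mul (measurable_sin.comp hθa)).div
    ((measurable_const.add hli).add ((measurable_const.sub hli).mul (measurable_cos.comp hθa))))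

/-- The NCP-mixture Jacobian factor is jointly measurable in (angle, parameters). -/
theorem measurable_ncpMixtureJac_prod {Y : Type*} [MeasurableSpace Y] {m : ℕ}
    {w a l : Y → Fin m → ℝ}
    (hw : ∀ i, Measurable fun y => w y i) (ha : ∀ i, Measurable fun y => a y i)
    (hlm : ∀ i, Measurable fun y => l y i) :
    Measurable fun q : ℝ × Y =>
      ∑ i, w q.2 i * (2 * l q.2 i / ((1 + l q.2 i ^ 2) + (1 - l q.2 i ^ 2) * cos (q.1 - a q.2 i))) := by
  refine Finset.measurable_sum _ fun i _ => ?_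
  have hai : Measurable fun q : ℝ × Y => a q.2 i := (ha i).comp measurable_snd
  have hli : Measurable fun q : ℝ × Y => l q.2 i := (hlm i).comp measurable_snd
  have hθa : Measurable fun q : ℝ × Y => q.1 - a q.2 i := measurable_fst.sub hai
  exact ((hw i).comp measurable_snd).mul ((measurable_const.mul hli).div
    ((measurable_const.add (hli.pow_const 2)).add
      ((measurable_const.sub (hli.pow_const 2)).mul (measurable_cos.comp hθa))))

variable {ι : Type*} {p : ι → Prop} {m : ℕ}

/-- **NCP-mixture coupling layers are measurable equivalences of `ι → U(1)`.**  For weights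
`w b y` (nonnegative, summing to one), scales `l b y > 0`, offsets `a b y` and shift `t b y`
measurable in the frozen links `y`, there is a family `ψ b y : U(1) ≃ᵐ U(1)` realising the NCP
mixture on representatives, with forward and inverse maps jointly measurable in
(link, frozen links). -/
theorem exists_coupleEquiv_ncpMixture
    (w a l : {i // p i} → ({i // ¬p i} → Circle) → Fin m → ℝ)
    (t : {i // p i} → ({i // ¬p i} → Circle) → ℝ)
    (hw : ∀ b i, Measurable fun y => w b y i) (ha : ∀ b i, Measurable fun y => a b y i)
    (hlm : ∀ b i, Measurable fun y => l b y i) (ht : ∀ b, Measurable (t b))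
    (hw0 : ∀ b y i, 0 ≤ w b y i) (hw1 : ∀ b y, ∑ i, w b y i = 1) (hl : ∀ b y i, 0 < l b y i) :
    ∃ ψ : {i // p i} → ({i // ¬p i} → Circle) → Circle ≃ᵐ Circle,
      (∀ b y (θ : ℝ), ψ b y (Circle.exp θ) = Circle.exp (t b y + ∑ i, w b y i * (a b y i +
        ((θ - a b y i) + 2 * arctan ((l b y i - 1) * sin (θ - a b y i) /
          ((1 + l b y i) + (1 - l b y i) * cos (θ - a b y i))))))) ∧
      (∀ b, Measurable fun q : Circle × ({i // ¬p i} → Circle) => ψ b q.2 q.1) ∧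
      (∀ b, Measurable fun q : Circle × ({i // ¬p i} → Circle) => (ψ b q.2).symm q.1) :=
  exists_coupleEquiv_of_hasDerivAt_pos
    (Φ := fun b y θ => t b y + ∑ i, w b y i * (a b y i + ((θ - a b y i) +
      2 * arctan ((l b y i - 1) * sin (θ - a b y i) /
        ((1 + l b y i) + (1 - l b y i) * cos (θ - a b y i))))))
    (Φ' := fun b y θ => ∑ i, w b y i *
      (2 * l b y i / ((1 + l b y i ^ 2) + (1 - l b y i ^ 2) * cos (θ - a b y i))))
    (fun b y => hasDerivAt_mixture (w b y) (a b y) (t b y) fun i θ => hasDerivAt_ncpLift (hl b y i) θ)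
    (fun b y => mixture_deriv_pos (w b y) (a b y) (hw0 b y) (hw1 b y) fun i θ => ncpJac_pos (hl b y i) θ)
    (fun b y => mixture_add_two_pi (w b y) (a b y) (t b y)
      (Φ := fun i θ => θ + 2 * arctan ((l b y i - 1) * sin θ / ((1 + l b y i) + (1 - l b y i) * cos θ)))
      (fun i θ => ncpLift_add_two_pi (l b y i) θ) (hw1 b y))
    fun b => measurable_ncpMixture_prod (hw b) (ha b) (hlm b) (ht b)

variable [Fintype ι] [DecidablePred p] {P : Type*} [MeasurableSpace P] {volP : Measure P}
  [SFinite volP]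

/-- **FT-HMC through a U(1) coupling layer with NCP-mixture link maps is exact.**  Links
`ι → U(1)` with the product Haar probability measure, momenta in any `(P, volP)`; the layer
`F = coupleEquiv ψ …` whose active links move by NCP mixtures (weights `w b y ≥ 0` summing to one,
scales `l b y > 0`, offsets `a b y`, shift `t b y`, all measurable in the frozen links; `ψ` any
family realising them, e.g. from `exists_coupleEquiv_ncpMixture`) with Jacobian
`J = coupleJac p jac`, `jac b y (e^{iθ}) = Σ_i w_i · 2l_i / ((1 + l_i²) + (1 − l_i²) cos(θ − a_i))`;
ANY measurable action `S`, kinetic term `T` and measurable `Haar^ι ⊗ volP`-preserving involution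
`Θ`.  Then the HMC kernel for `H̃ = (S ∘ F − log J) + T` reported through `F × id` leaves
`e^{−(S + T)} · Haar^ι ⊗ volP` invariant. -/
theorem thmc_hmc_exact_coupleEquiv_ncpMixture
    (w a l : {i // p i} → ({i // ¬p i} → Circle) → Fin m → ℝ)
    (t : {i // p i} → ({i // ¬p i} → Circle) → ℝ)
    (hw : ∀ b i, Measurable fun y => w b y i) (ha : ∀ b i, Measurable fun y => a b y i)
    (hlm : ∀ b i, Measurable fun y => l b y i) (ht : ∀ b, Measurable (t b))
    (hw0 : ∀ b y i, 0 ≤ w b y i) (hw1 : ∀ b y, ∑ i, w b y i = 1) (hl : ∀ b y i, 0 < l b y i)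
    (ψ : {i // p i} → ({i // ¬p i} → Circle) → Circle ≃ᵐ Circle)
    (hψ : ∀ b y (θ : ℝ), ψ b y (Circle.exp θ) = Circle.exp (t b y + ∑ i, w b y i * (a b y i +
      ((θ - a b y i) + 2 * arctan ((l b y i - 1) * sin (θ - a b y i) /
        ((1 + l b y i) + (1 - l b y i) * cos (θ - a b y i)))))))
    (hψm : ∀ b, Measurable fun q : Circle × ({i // ¬p i} → Circle) => ψ b q.2 q.1)
    (hψsm : ∀ b, Measurable fun q : Circle × ({i // ¬p i} → Circle) => (ψ b q.2).symm q.1)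
    {jac : {i // p i} → ({i // ¬p i} → Circle) → Circle → ℝ}
    (hjac : ∀ b y (θ : ℝ), jac b y (Circle.exp θ) =
      ∑ i, w b y i * (2 * l b y i / ((1 + l b y i ^ 2) + (1 - l b y i ^ 2) * cos (θ - a b y i))))
    {S : (ι → Circle) → ℝ} (hS : Measurable S) {T : P → ℝ} (hT : Measurable T)
    {Θ : (ι → Circle) × P → (ι → Circle) × P} {hΘ : Measurable Θ} (hinv : Function.Involutive Θ)
    (hvol : MeasurePreserving Θ
      ((Measure.pi fun _ : ι => haarProbability Circle).prod volP)
      ((Measure.pi fun _ : ι => haarProbability Circle).prod volP)) :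
    Invariant
      (conjKernel (involMH Θ hΘ fun z : (ι → Circle) × P =>
          (S (coupleEquiv ψ hψm hψsm z.1) - Real.log (coupleJac p jac z.1)) + T z.2)
        ((coupleEquiv ψ hψm hψsm).prodCongr (MeasurableEquiv.refl P)))
      (((Measure.pi fun _ : ι => haarProbability Circle).prod volP).withDensity
        fun z => ENNReal.ofReal (Real.exp (-(S z.1 + T z.2)))) :=
  thmc_hmc_exact_coupleEquiv_of_degreeOne
    (Φ := fun b y θ => t b y + ∑ i, w b y i * (a b y i + ((θ - a b y i) +
      2 * arctan ((l b y i - 1) * sin (θ - a b y i) /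
        ((1 + l b y i) + (1 - l b y i) * cos (θ - a b y i))))))
    (Φ' := fun b y θ => ∑ i, w b y i *
      (2 * l b y i / ((1 + l b y i ^ 2) + (1 - l b y i ^ 2) * cos (θ - a b y i))))
    (fun b y => hasDerivAt_mixture (w b y) (a b y) (t b y) fun i θ => hasDerivAt_ncpLift (hl b y i) θ)
    (fun b y => continuous_finsetSum _ fun i _ => continuous_const.mul
      ((continuous_ncpJac (hl b y i)).comp (continuous_id.sub continuous_const)))
    (fun b y => mixture_deriv_pos (w b y) (a b y) (hw0 b y) (hw1 b y) fun i θ => ncpJac_pos (hl b y i) θ)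
    (fun b y => mixture_add_two_pi (w b y) (a b y) (t b y)
      (Φ := fun i θ => θ + 2 * arctan ((l b y i - 1) * sin θ / ((1 + l b y i) + (1 - l b y i) * cos θ)))
      (fun i θ => ncpLift_add_two_pi (l b y i) θ) (hw1 b y))
    (fun b => measurable_ncpMixture_prod (hw b) (ha b) (hlm b) (ht b))
    (fun b => measurable_ncpMixtureJac_prod (hw b) (ha b) (hlm b))
    ψ hψ hψm hψsm hjac hS hT hinv hvol

end NCP

/-! ## Members: lists of certified layers -/

section Layers

variable {Ω : Type*} [MeasurableSpace Ω] {vol : Measure Ω}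

/-- **Two certified layers compose**: if `F₁`, `F₂` have Jacobians `J₁`, `J₂ ≥ 0` (as
`ofReal`-densities) then the member `F₂ ∘ F₁ = F₁.trans F₂` has Jacobian `v ↦ J₁(v) J₂(F₁ v)`
(log-dets add along the member). -/
theorem hasJacobian_trans {F₁ F₂ : Ω ≃ᵐ Ω} {J₁ J₂ : Ω → ℝ}
    (h₁ : HasJacobian vol F₁ fun v => ENNReal.ofReal (J₁ v))
    (h₂ : HasJacobian vol F₂ fun v => ENNReal.ofReal (J₂ v)) (hJ₂ : ∀ v, 0 ≤ J₂ v) :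
    HasJacobian vol (F₁.trans F₂) fun v => ENNReal.ofReal (J₁ v * J₂ (F₁ v)) := by
  have hfun : (fun v => ENNReal.ofReal (J₁ v * J₂ (F₁ v))) =
      fun v => ENNReal.ofReal (J₂ (F₁ v)) * ENNReal.ofReal (J₁ v) :=
    funext fun v => by rw [mul_comm, ENNReal.ofReal_mul (hJ₂ _)]
  rw [hfun, MeasurableEquiv.coe_trans]
  exact h₂.comp h₁

/-- **A member is a list of certified layers.**  For a list of layers `(F_k, J_k)` — each a
measurable equivalence with `HasJacobian vol F_k (ofReal ∘ J_k)`, `J_k > 0` measurable — the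
member `F_n ∘ ⋯ ∘ F_1` (apply the head of the list first) is a measurable equivalence with
Jacobian `v ↦ J_1(v) · J_2(F_1 v) · ⋯ · J_n(F_{n−1} ⋯ F_1 v)`, which is positive and measurable:
exactly the running log-det sum the engine accumulates along a member. -/
theorem hasJacobian_foldr_trans (layers : List ((Ω ≃ᵐ Ω) × (Ω → ℝ)))
    (hpos : ∀ L ∈ layers, ∀ v, 0 < L.2 v) (hmeas : ∀ L ∈ layers, Measurable L.2)
    (hjac : ∀ L ∈ layers, HasJacobian vol L.1 fun v => ENNReal.ofReal (L.2 v)) :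
    (∀ v, 0 < layers.foldr (fun L K => fun v => L.2 v * K (L.1 v)) (fun _ => (1 : ℝ)) v) ∧
    Measurable (layers.foldr (fun L K => fun v => L.2 v * K (L.1 v)) (fun _ => (1 : ℝ))) ∧
    HasJacobian vol ⇑(layers.foldr (fun L (G : Ω ≃ᵐ Ω) => L.1.trans G) (MeasurableEquiv.refl Ω))
      fun v => ENNReal.ofReal
        (layers.foldr (fun L K => fun v => L.2 v * K (L.1 v)) (fun _ => (1 : ℝ)) v) := by
  induction layers with
  | nil =>
    simp only [List.foldr_nil]
    refine ⟨fun _ => one_pos, measurable_const, ?_⟩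
    rw [ENNReal.ofReal_one]
    exact hasJacobian_id vol
  | cons L rest ih =>
    obtain ⟨ihpos, ihmeas, ihjac⟩ := ih (fun L' hL' => hpos L' (List.mem_cons_of_mem _ hL'))
      (fun L' hL' => hmeas L' (List.mem_cons_of_mem _ hL'))
      (fun L' hL' => hjac L' (List.mem_cons_of_mem _ hL'))
    have hL : L ∈ L :: rest := List.mem_cons_self
    simp only [List.foldr_cons]
    exact ⟨fun v => mul_pos (hpos L hL v) (ihpos _),
      (hmeas L hL).mul (ihmeas.comp L.1.measurable),
      hasJacobian_trans (hjac L hL) ihjac fun v => (ihpos v).le⟩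

variable {P : Type*} [MeasurableSpace P] {volP : Measure P} [SFinite vol] [SFinite volP]

/-- **FT-HMC through a member (a list of certified layers) is exact.**  Reference `vol ⊗ volP` on
phase space `Ω × P`, target `e^{−(S + T)} · vol ⊗ volP`; member `F` and Jacobian `J` assembled
from the list as in `hasJacobian_foldr_trans`; ANY measurable `vol ⊗ volP`-preserving involution
`Θ`.  Then the HMC kernel for `H̃ = (S ∘ F − log J) + T` reported through `F × id` leaves the
target invariant. -/
theorem thmc_hmc_exact_foldr (layers : List ((Ω ≃ᵐ Ω) × (Ω → ℝ)))
    (hpos : ∀ L ∈ layers, ∀ v, 0 < L.2 v) (hmeas : ∀ L ∈ layers, Measurable L.2)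
    (hjac : ∀ L ∈ layers, HasJacobian vol L.1 fun v => ENNReal.ofReal (L.2 v))
    {S : Ω → ℝ} (hS : Measurable S) {T : P → ℝ} (hT : Measurable T)
    {Θ : Ω × P → Ω × P} {hΘ : Measurable Θ} (hinv : Function.Involutive Θ)
    (hvol : MeasurePreserving Θ (vol.prod volP) (vol.prod volP)) :
    Invariant
      (conjKernel (involMH Θ hΘ fun z : Ω × P =>
          (S (layers.foldr (fun L (G : Ω ≃ᵐ Ω) => L.1.trans G) (MeasurableEquiv.refl Ω) z.1) -
            Real.log (layers.foldr (fun L K => fun v => L.2 v * K (L.1 v)) (fun _ => (1 : ℝ)) z.1)) +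
          T z.2)
        ((layers.foldr (fun L (G : Ω ≃ᵐ Ω) => L.1.trans G) (MeasurableEquiv.refl Ω)).prodCongr
          (MeasurableEquiv.refl P)))
      ((vol.prod volP).withDensity fun z => ENNReal.ofReal (Real.exp (-(S z.1 + T z.2)))) := by
  obtain ⟨h0, hm, hJ⟩ := hasJacobian_foldr_trans layers hpos hmeas hjac
  exact thmc_hmc_exact h0 hm hJ hS hT hinv hvol

end Layers

end Summit.Ventures.LatticeQCDFlow.Exactness
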